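import Summits.KontsevichZagierPeriods.KontsevichZagierPeriods.Theses.ComplexOrientations
import HarnessLib

/-!
# Route ComplexOrientations — conics: normal form, reducibility of degenerate conics, sign at
# infinity (calibration input for `ComplexOrientationIdentity` on conics)

Elementary algebra of polynomials `p ∈ ℚ[x₀, x₁]` of total degree `≤ 2`, for the unconditional
CONIC SLICE of the values item `ComplexOrientationIdentity` (stmt-KontsevichZagierPeriods-11371)
of route `KontsevichZagierPeriods/ComplexOrientations` (companion files
`…ComplexOrientationIdentityEllipse`, `…ComplexOrientationIdentityConics`):

* `exists_eq_quadric_of_totalDegree_le_two` — normal form `a x₀² + b x₀x₁ + c x₁² + d x₀ + e x₁ + f`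
  (coefficient extraction via `MvPolynomial.ext`), with its evaluation and partial derivatives;
* `not_irreducible_of_C_mul_eq` — a conic a constant multiple of which is `ℓ² + 2δℓ + γ` in one
  rational linear form `ℓ` factors over `ℂ` (`ℂ` algebraically closed; a polynomial with a zero is
  not a unit), so it is not irreducible in `ℂ[x₀, x₁]`; constants are not irreducible either;
* `leadingForm_nonneg`, `linearPart_eq_zero_of_leadingForm_eq_zero` — if the real quadratic is
  positive outside a ball then its leading form is positive semidefinite and its linear part
  vanishes on the kernel of the leading form (test rays `t ↦ t w`);
* `isPreconnected_setOf_lt_norm`, `forall_pos_or_forall_neg_of_isPreconnected` — the exterior of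
  a ball of the plane is preconnected, so a polynomial without zeros there has constant sign;
* small helpers (`aeval_quadric_real`, `isAlgebraic_two_div_sqrt_mul`, …).

Everything is proved (theorems only, standard axioms).
-/

noncomputable section

open MvPolynomial Set

namespace Summit.KontsevichZagierPeriods.ComplexOrientations

/-! ### Normal form in total degree `≤ 2` -/
/-- An exponent vector on `Fin 2` equals `single 0 i + single 1 j` iff its values are `i, j`.
[folklore] -/
theorem eq_single_add_single_iff (m : Fin 2 →₀ ℕ) (i j : ℕ) :
    m = Finsupp.single 0 i + Finsupp.single 1 j ↔ m 0 = i ∧ m 1 = j := by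
  constructor
  · rintro rfl
    simp
  · rintro ⟨h0, h1⟩
    ext k
    fin_cases k <;> simp [h0, h1]

/-- The degree of `single 0 i + single 1 j` is `i + j`. [folklore] -/
theorem sum_single_add_single (i j : ℕ) :
    ((Finsupp.single (0 : Fin 2) i + Finsupp.single 1 j : Fin 2 →₀ ℕ).sum fun _ e => e) = i + j := by
  rw [Finsupp.sum_fintype, Fin.sum_univ_two]
  · simp
  · intro _; rfl

/-- **Normal form in total degree `≤ 2`**: a polynomial `p ∈ ℚ[x₀, x₁]` of total degree at most
two is `a x₀² + b x₀x₁ + c x₁² + d x₀ + e x₁ + f` with its six coefficients. [folklore] -/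
theorem exists_eq_quadric_of_totalDegree_le_two (p : MvPolynomial (Fin 2) ℚ)
    (hp : p.totalDegree ≤ 2) :
    ∃ a b c d e f : ℚ, p = C a * X 0 ^ 2 + C b * (X 0 * X 1) + C c * X 1 ^ 2 + C d * X 0 +
      C e * X 1 + C f := by
  refine ⟨coeff (Finsupp.single 0 2 + Finsupp.single 1 0) p,
    coeff (Finsupp.single 0 1 + Finsupp.single 1 1) p,
    coeff (Finsupp.single 0 0 + Finsupp.single 1 2) p,
    coeff (Finsupp.single 0 1 + Finsupp.single 1 0) p,
    coeff (Finsupp.single 0 0 + Finsupp.single 1 1) p,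
    coeff (Finsupp.single 0 0 + Finsupp.single 1 0) p, ?_⟩
  have hX0 : (X 0 : MvPolynomial (Fin 2) ℚ) = monomial (Finsupp.single 0 1) 1 := rfl
  have hX1 : (X 1 : MvPolynomial (Fin 2) ℚ) = monomial (Finsupp.single 1 1) 1 := rfl
  have hCf : ∀ r : ℚ, (C r : MvPolynomial (Fin 2) ℚ) = monomial 0 r := fun r => rfl
  apply MvPolynomial.ext
  intro m
  obtain ⟨i, j, rfl⟩ : ∃ i j : ℕ, m = Finsupp.single 0 i + Finsupp.single 1 j :=
    ⟨m 0, m 1, by ext l; fin_cases l <;> simp⟩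
  simp only [hX0, hX1, hCf, monomial_pow, monomial_mul, coeff_add, coeff_monomial,
    eq_single_add_single_iff, Finsupp.smul_single, smul_eq_mul, mul_one, one_pow,
    Finsupp.coe_add, Pi.add_apply, Finsupp.single_eq_same, Finsupp.single_eq_of_ne one_ne_zero,
    Finsupp.single_eq_of_ne zero_ne_one, Finsupp.coe_zero, Pi.zero_apply, add_zero, zero_add,
    Finsupp.single_zero]
  by_cases hij : i + j ≤ 2
  · have hi : i ≤ 2 := by omega
    have hj : j ≤ 2 := by omega
    interval_cases i <;> interval_cases j <;> simp_all
  · -- not in the support: both sides vanish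
    have hm : Finsupp.single (0 : Fin 2) i + Finsupp.single 1 j ∉ p.support := fun hmem => hij (by
      have := le_totalDegree hmem
      rw [sum_single_add_single] at this
      exact this.trans hp)
    rw [notMem_support_iff.1 hm]
    have h1 : ¬ (2 = i ∧ 0 = j) := by omega
    have h2 : ¬ (1 = i ∧ 1 = j) := by omega
    have h3 : ¬ (0 = i ∧ 2 = j) := by omega
    have h4 : ¬ (1 = i ∧ 0 = j) := by omega
    have h5 : ¬ (0 = i ∧ 1 = j) := by omega
    have h6 : ¬ (0 = i ∧ 0 = j) := by omega
    simp [h1, h2, h3, h4, h5, h6]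

/-- Evaluating the normal form. [folklore] -/
theorem aeval_quadric {S : Type*} [CommRing S] [Algebra ℚ S] (a b c d e f : ℚ) (g : Fin 2 → S) :
    aeval g (C a * X 0 ^ 2 + C b * (X 0 * X 1) + C c * X 1 ^ 2 + C d * X 0 + C e * X 1 + C f :
      MvPolynomial (Fin 2) ℚ) =
      algebraMap ℚ S a * g 0 ^ 2 + algebraMap ℚ S b * (g 0 * g 1) + algebraMap ℚ S c * g 1 ^ 2 +
        algebraMap ℚ S d * g 0 + algebraMap ℚ S e * g 1 + algebraMap ℚ S f := by
  simp only [map_add, map_mul, map_pow, aeval_C, aeval_X]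

/-- The partial derivative `∂/∂x₀` of the normal form. [folklore] -/
theorem pderiv_zero_quadric (a b c d e f : ℚ) :
    pderiv 0 (C a * X 0 ^ 2 + C b * (X 0 * X 1) + C c * X 1 ^ 2 + C d * X 0 + C e * X 1 + C f :
      MvPolynomial (Fin 2) ℚ) = C (2 * a) * X 0 + C b * X 1 + C d := by
  simp only [map_add, Derivation.leibniz, Derivation.leibniz_pow, pderiv_C, pderiv_X_self,
    pderiv_X_of_ne (show (1 : Fin 2) ≠ 0 by decide), add_zero, smul_eq_mul, mul_one, mul_zero,
    map_mul, map_ofNat]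
  ring

/-- The partial derivative `∂/∂x₁` of the normal form. [folklore] -/
theorem pderiv_one_quadric (a b c d e f : ℚ) :
    pderiv 1 (C a * X 0 ^ 2 + C b * (X 0 * X 1) + C c * X 1 ^ 2 + C d * X 0 + C e * X 1 + C f :
      MvPolynomial (Fin 2) ℚ) = C b * X 0 + C (2 * c) * X 1 + C e := by
  simp only [map_add, Derivation.leibniz, Derivation.leibniz_pow, pderiv_C, pderiv_X_self,
    pderiv_X_of_ne (show (0 : Fin 2) ≠ 1 by decide), add_zero, smul_eq_mul, mul_one, mul_zero,
    map_mul, map_ofNat]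
  ring



/-! ### Degenerate conics are reducible over `ℂ` -/

/-- A constant polynomial is not irreducible over `ℂ` (it is `0` or a unit). [folklore] -/
theorem not_irreducible_map_C (f : ℚ) :
    ¬ Irreducible (map (algebraMap ℚ ℂ) (C f : MvPolynomial (Fin 2) ℚ)) := by
  rw [map_C]
  by_cases hf : f = 0
  · rw [hf, map_zero, C_0]
    exact not_irreducible_zero
  · exact fun h => h.not_isUnit (IsUnit.map C ((algebraMap ℚ ℂ).isUnit_map (Ne.isUnit hf)))

/-- A complex affine-linear function `α w₀ + β w₁ + γ` with `(α, β) ≠ 0` has a zero. [folklore] -/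
theorem exists_linear_eq_zero (α β γ : ℂ) (h : α ≠ 0 ∨ β ≠ 0) :
    ∃ w : Fin 2 → ℂ, α * w 0 + β * w 1 + γ = 0 := by
  rcases h with hα | hβ
  · refine ⟨![-γ / α, 0], ?_⟩
    simp only [Matrix.cons_val_zero, Matrix.cons_val_one]
    field_simp
    ring
  · refine ⟨![0, -γ / β], ?_⟩
    simp only [Matrix.cons_val_zero, Matrix.cons_val_one]
    field_simp
    ring

/-- A polynomial over `ℂ` with a zero is not a unit. [folklore] -/
theorem not_isUnit_of_eval_eq_zero {q : MvPolynomial (Fin 2) ℂ} {w : Fin 2 → ℂ}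
    (hw : eval w q = 0) : ¬ IsUnit q := fun hu => by
  have := hu.map (eval w)
  rw [hw] at this
  exact not_isUnit_zero this

/-- **Degenerate conics are reducible.** If a non-zero constant multiple of `p ∈ ℚ[x₀, x₁]` is a
quadratic polynomial `ℓ² + 2δ ℓ + γ` in one rational linear form `ℓ = α x₀ + β x₁ ≠ 0`, then
`p` factors over `ℂ` into two linear factors, so it is not irreducible in `ℂ[x₀, x₁]`. [folklore] -/
theorem not_irreducible_of_C_mul_eq (p : MvPolynomial (Fin 2) ℚ) (κ α β δ γ : ℚ) (hκ : κ ≠ 0)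
    (hαβ : α ≠ 0 ∨ β ≠ 0)
    (h : C κ * p = (C α * X 0 + C β * X 1) ^ 2 + C (2 * δ) * (C α * X 0 + C β * X 1) + C γ) :
    ¬ Irreducible (map (algebraMap ℚ ℂ) p) := by
  intro hirr
  set φ := algebraMap ℚ ℂ with hφ
  -- a square root of the discriminant
  obtain ⟨z, hz⟩ := IsAlgClosed.exists_eq_mul_self (φ δ ^ 2 - φ γ)
  set ℓ : MvPolynomial (Fin 2) ℂ := C (φ α) * X 0 + C (φ β) * X 1 with hℓ
  have hmap : C (φ κ) * map φ p = ℓ ^ 2 + C (2 * φ δ) * ℓ + C (φ γ) := by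
    have := congrArg (MvPolynomial.map φ) h
    simpa only [map_mul (MvPolynomial.map φ), map_add, map_pow, map_C, map_X, map_mul φ, map_ofNat] using this
  have hfac : map φ p = (C (φ κ)⁻¹ * (ℓ + C (φ δ + z))) * (ℓ + C (φ δ - z)) := by
    have hκ' : φ κ ≠ 0 := (map_ne_zero φ).2 hκ
    have hz' : C (φ δ + z) * C (φ δ - z) = (C (φ γ) : MvPolynomial (Fin 2) ℂ) := by
      rw [← map_mul]; congr 1; linear_combination hz
    calc map φ p = C (φ κ)⁻¹ * (C (φ κ) * map φ p) := by
          rw [← mul_assoc, ← C_mul, inv_mul_cancel₀ hκ', C_1, one_mul]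
      _ = C (φ κ)⁻¹ * (ℓ ^ 2 + C (2 * φ δ) * ℓ + C (φ γ)) := by rw [hmap]
      _ = (C (φ κ)⁻¹ * (ℓ + C (φ δ + z))) * (ℓ + C (φ δ - z)) := by
          rw [← hz']
          simp only [map_add, map_sub, map_mul, map_ofNat]
          ring
  have hαβ' : φ α ≠ 0 ∨ φ β ≠ 0 := by
    rcases hαβ with h | h
    · exact Or.inl ((map_ne_zero φ).2 h)
    · exact Or.inr ((map_ne_zero φ).2 h)
  rcases hirr.isUnit_or_isUnit hfac with hu | hu
  · obtain ⟨w, hw⟩ := exists_linear_eq_zero (φ α) (φ β) (φ δ + z) hαβ'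
    refine not_isUnit_of_eval_eq_zero (w := w) ?_ hu
    simp only [hℓ, map_mul, map_add, eval_C, eval_X]
    rw [hw, mul_zero]
  · obtain ⟨w, hw⟩ := exists_linear_eq_zero (φ α) (φ β) (φ δ - z) hαβ'
    refine not_isUnit_of_eval_eq_zero (w := w) ?_ hu
    simp only [hℓ, map_mul, map_add, eval_C, eval_X]
    exact hw

/-! ### Sign analysis at infinity: a quadratic positive near infinity has a positive semidefinite
leading form whose kernel kills the linear part -/

/-- A real quadratic `q t² + L t + f` with `q < 0` is negative for all large `t`. [folklore] -/
theorem exists_forall_ge_quadratic_neg {q L f : ℝ} (hq : q < 0) (T₀ : ℝ) :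
    ∃ t : ℝ, T₀ ≤ t ∧ 1 ≤ t ∧ q * t ^ 2 + L * t + f < 0 := by
  set t : ℝ := max (max T₀ 1) ((|L| + |f| + 1) / (-q)) with ht
  have h1 : 1 ≤ t := le_trans (le_max_right _ _) (le_max_left _ _)
  have h2 : (|L| + |f| + 1) / (-q) ≤ t := le_max_right _ _
  refine ⟨t, le_trans (le_max_left _ _) (le_max_left _ _), h1, ?_⟩
  have hq' : 0 < -q := by linarith
  have h3 : q * t ≤ -(|L| + |f| + 1) := by
    rw [div_le_iff₀ hq'] at h2
    linarith
  have h4 : L * t ≤ |L| * t := mul_le_mul_of_nonneg_right (le_abs_self L) (by linarith)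
  have h5 : f ≤ |f| * t := by
    calc f ≤ |f| := le_abs_self f
      _ = |f| * 1 := (mul_one _).symm
      _ ≤ |f| * t := mul_le_mul_of_nonneg_left h1 (abs_nonneg f)
  have h6 : q * t ^ 2 + L * t + f ≤ t * (q * t + |L| + |f|) := by nlinarith
  have h7 : t * (q * t + |L| + |f|) < 0 := mul_neg_of_pos_of_neg (by linarith) (by linarith)
  linarith

/-- A real affine function `L t + f` with `L ≠ 0` is negative at some `t` of absolute value as
large as we please. [folklore] -/
theorem exists_abs_ge_linear_neg {L f : ℝ} (hL : L ≠ 0) (T₀ : ℝ) :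
    ∃ t : ℝ, T₀ ≤ |t| ∧ L * t + f < 0 := by
  rcases lt_or_gt_of_ne hL with hL | hL
  · have hL' : 0 < -L := by linarith
    have hq : 0 ≤ (|f| + 1) / (-L) := div_nonneg (by positivity) hL'.le
    refine ⟨max T₀ 0 + (|f| + 1) / (-L), ?_, ?_⟩
    · rw [abs_of_nonneg (add_nonneg (le_max_right _ _) hq)]
      linarith [le_max_left T₀ 0]
    · have h1 : L * ((|f| + 1) / (-L)) = -(|f| + 1) := by field_simp
      have h2 : L * max T₀ 0 ≤ 0 := mul_nonpos_of_nonpos_of_nonneg hL.le (le_max_right _ _)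
      rw [mul_add, h1]
      linarith [le_abs_self f]
  · refine ⟨-(max T₀ 0 + (|f| + 1) / L), ?_, ?_⟩
    · have : 0 ≤ max T₀ 0 + (|f| + 1) / L := by positivity
      rw [abs_neg, abs_of_nonneg this]
      have : 0 ≤ (|f| + 1) / L := by positivity
      linarith [le_max_left T₀ 0]
    · have h1 : L * ((|f| + 1) / L) = |f| + 1 := by field_simp
      have h2 : 0 ≤ L * max T₀ 0 := mul_nonneg hL.le (le_max_right _ _)
      rw [mul_neg, mul_add, h1]
      linarith [le_abs_self f]

section SignAtInfinity

variable {a b c d e f M : ℝ}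
  (hpos : ∀ v : Fin 2 → ℝ, M < ‖v‖ →
    0 < a * v 0 ^ 2 + b * (v 0 * v 1) + c * v 1 ^ 2 + d * v 0 + e * v 1 + f)
include hpos

/-- If the quadratic is positive near infinity, its leading form is positive semidefinite.
[folklore] -/
theorem leadingForm_nonneg (w : Fin 2 → ℝ) : 0 ≤ a * w 0 ^ 2 + b * (w 0 * w 1) + c * w 1 ^ 2 := by
  by_contra hneg
  push Not at hneg
  have hw : w ≠ 0 := by
    rintro rfl
    simp at hneg
  have hnorm : 0 < ‖w‖ := norm_pos_iff.2 hw
  obtain ⟨t, ht₀, ht1, hlt⟩ := exists_forall_ge_quadratic_neg (L := d * w 0 + e * w 1) (f := f) hneg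
    (|M| / ‖w‖ + 1)
  have htpos : 0 < t := by linarith
  have hbig : M < ‖t • w‖ := by
    rw [norm_smul, Real.norm_eq_abs, abs_of_pos htpos]
    have : |M| / ‖w‖ * ‖w‖ = |M| := div_mul_cancel₀ _ hnorm.ne'
    nlinarith [le_abs_self M]
  have := hpos (t • w) hbig
  simp only [Pi.smul_apply, smul_eq_mul] at this
  nlinarith

/-- If the quadratic is positive near infinity, the linear part vanishes on the kernel of the
leading form. [folklore] -/
theorem linearPart_eq_zero_of_leadingForm_eq_zero (w : Fin 2 → ℝ)
    (hw0 : a * w 0 ^ 2 + b * (w 0 * w 1) + c * w 1 ^ 2 = 0) : d * w 0 + e * w 1 = 0 := by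
  by_contra hL
  have hw : w ≠ 0 := by
    rintro rfl
    simp at hL
  have hnorm : 0 < ‖w‖ := norm_pos_iff.2 hw
  obtain ⟨t, ht, hlt⟩ := exists_abs_ge_linear_neg (f := f) hL (|M| / ‖w‖ + 1)
  have hbig : M < ‖t • w‖ := by
    rw [norm_smul, Real.norm_eq_abs]
    have : |M| / ‖w‖ * ‖w‖ = |M| := div_mul_cancel₀ _ hnorm.ne'
    nlinarith [le_abs_self M, abs_nonneg t]
  have := hpos (t • w) hbig
  simp only [Pi.smul_apply, smul_eq_mul] at this
  have hq : a * (t * w 0) ^ 2 + b * (t * w 0 * (t * w 1)) + c * (t * w 1) ^ 2 = 0 := by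
    have : a * (t * w 0) ^ 2 + b * (t * w 0 * (t * w 1)) + c * (t * w 1) ^ 2 =
        t ^ 2 * (a * w 0 ^ 2 + b * (w 0 * w 1) + c * w 1 ^ 2) := by ring
    rw [this, hw0, mul_zero]
  nlinarith

end SignAtInfinity

/-! ### The exterior of a ball in the plane is connected; sign at infinity -/

/-- The exterior `{M < ‖v‖}` of a (sup-norm) ball of the plane `Fin 2 → ℝ` is preconnected: it is
all of the plane if `M < 0`, and otherwise the union of the four open half-planes
`{±vᵢ > M}`, consecutive ones of which meet. [folklore] -/
theorem isPreconnected_setOf_lt_norm (M : ℝ) : IsPreconnected {v : Fin 2 → ℝ | M < ‖v‖} := by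
  rcases lt_or_ge M 0 with hM | hM
  · have : {v : Fin 2 → ℝ | M < ‖v‖} = univ :=
      eq_univ_of_forall fun v => lt_of_lt_of_le hM (norm_nonneg v)
    rw [this]
    exact isPreconnected_univ
  set H₁ : Set (Fin 2 → ℝ) := {v | M < v 0}
  set H₂ : Set (Fin 2 → ℝ) := {v | M < v 1}
  set H₃ : Set (Fin 2 → ℝ) := {v | v 0 < -M}
  set H₄ : Set (Fin 2 → ℝ) := {v | v 1 < -M}
  have hlin0 : IsLinearMap ℝ fun v : Fin 2 → ℝ => v 0 := (LinearMap.proj 0).isLinear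
  have hlin1 : IsLinearMap ℝ fun v : Fin 2 → ℝ => v 1 := (LinearMap.proj 1).isLinear
  have h₁ : IsPreconnected H₁ := (convex_halfSpace_gt hlin0 M).isPreconnected
  have h₂ : IsPreconnected H₂ := (convex_halfSpace_gt hlin1 M).isPreconnected
  have h₃ : IsPreconnected H₃ := (convex_halfSpace_lt hlin0 (-M)).isPreconnected
  have h₄ : IsPreconnected H₄ := (convex_halfSpace_lt hlin1 (-M)).isPreconnected
  have hset : {v : Fin 2 → ℝ | M < ‖v‖} = ((H₁ ∪ H₂) ∪ H₃) ∪ H₄ := by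
    ext v
    simp only [mem_setOf_eq, mem_union, H₁, H₂, H₃, H₄]
    rw [← not_le, pi_norm_le_iff_of_nonneg hM, Fin.forall_fin_two, Real.norm_eq_abs,
      Real.norm_eq_abs, abs_le, abs_le]
    constructor
    · intro h
      by_contra h'
      push Not at h'
      exact h ⟨⟨h'.1.2, h'.1.1.1⟩, h'.2, h'.1.1.2⟩
    · intro h hc
      obtain ⟨⟨h1, h2⟩, h3, h4⟩ := hc
      rcases h with ((h | h) | h) | h <;> linarith
  rw [hset]
  have h12 : IsPreconnected (H₁ ∪ H₂) :=
    IsPreconnected.union ![M + 1, M + 1] (by simp [H₁]) (by simp [H₂]) h₁ h₂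
  have h123 : IsPreconnected ((H₁ ∪ H₂) ∪ H₃) :=
    IsPreconnected.union ![-(M + 1), M + 1] (Or.inr (by simp [H₂])) (by simp [H₃]) h12 h₃
  exact IsPreconnected.union ![M + 1, -(M + 1)] (Or.inl (Or.inl (by simp [H₁]))) (by simp [H₄])
    h123 h₄

/-- A continuous function without zeros on a preconnected set is everywhere positive or everywhere
negative there. [folklore] -/
theorem forall_pos_or_forall_neg_of_isPreconnected {X : Type*} [TopologicalSpace X] {S : Set X}
    (hS : IsPreconnected S) {g : X → ℝ} (hg : Continuous g) (h0 : ∀ v ∈ S, g v ≠ 0) :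
    (∀ v ∈ S, 0 < g v) ∨ (∀ v ∈ S, g v < 0) := by
  by_contra h
  push Not at h
  obtain ⟨⟨u, hu, hgu⟩, ⟨w, hw, hgw⟩⟩ := h
  obtain ⟨z, hz, hz0⟩ := hS.intermediate_value hu hw hg.continuousOn ⟨hgu, hgw⟩
  exact h0 z hz hz0

/-! ### Small helpers for the conic slice -/

/-- If `B t + C t² ≥ 0` for all real `t` then `B = 0`. [folklore] -/
theorem eq_zero_of_forall_linear_add_sq_nonneg {B C' : ℝ} (hC : 0 ≤ C')
    (h : ∀ t : ℝ, 0 ≤ B * t + C' * t ^ 2) : B = 0 := by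
  by_contra hB
  have := h (-B / (C' + 1))
  have hC1 : 0 < C' + 1 := by linarith
  have key : B * (-B / (C' + 1)) + C' * (-B / (C' + 1)) ^ 2 = -(B ^ 2 / (C' + 1) ^ 2) := by
    field_simp
    ring
  rw [key] at this
  have : 0 < B ^ 2 / (C' + 1) ^ 2 := by positivity
  linarith

/-- Evaluating the normal form at a real point. [folklore] -/
theorem aeval_quadric_real (a b c d e f : ℚ) (v : Fin 2 → ℝ) :
    aeval v (C a * X 0 ^ 2 + C b * (X 0 * X 1) + C c * X 1 ^ 2 + C d * X 0 + C e * X 1 + C f :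
      MvPolynomial (Fin 2) ℚ) =
      (a : ℝ) * v 0 ^ 2 + b * (v 0 * v 1) + c * v 1 ^ 2 + d * v 0 + e * v 1 + f := by
  rw [aeval_quadric]
  simp only [eq_ratCast]

/-- `2ρ/√D` is algebraic for rational `ρ` and rational `D > 0`. [folklore] -/
theorem isAlgebraic_two_div_sqrt_mul {D ρ : ℚ} (hD : 0 < D) :
    IsAlgebraic ℚ (2 / Real.sqrt D * ρ : ℝ) := by
  have hsqrt : IsAlgebraic ℚ (Real.sqrt D) := by
    refine ⟨Polynomial.X ^ 2 - Polynomial.C D, Polynomial.X_pow_sub_C_ne_zero two_pos D, ?_⟩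
    simp only [map_sub, map_pow, Polynomial.aeval_X, Polynomial.aeval_C, eq_ratCast]
    rw [Real.sq_sqrt (by exact_mod_cast hD.le), sub_self]
  have h2 : IsAlgebraic ℚ (2 : ℝ) := by
    simpa using isAlgebraic_algebraMap (R := ℚ) (A := ℝ) (2 : ℚ)
  have hρ : IsAlgebraic ℚ (ρ : ℝ) := by
    simpa [eq_ratCast] using isAlgebraic_algebraMap (R := ℚ) (A := ℝ) ρ
  exact (h2.mul hsqrt.inv).mul hρ


end Summit.KontsevichZagierPeriods.ComplexOrientations
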